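import Literature.RepresentationTheory.Kovacevic2021.SU21Irreducible
import Literature.RepresentationTheory.Kovacevic2021.SU21UnitarityRays
import Summits.HodgeConjecture.HodgeConjecture.Theorems.F0P3bKovLieTransports
import Summits.HodgeConjecture.HodgeConjecture.Theorems.F0P3bKTypeIntegration
import HarnessLib

/-!
# FLOOR-0 P3b «ENGINE local packets», line `F0_LocalAPackets` — KOVAČEVIĆ TRANSPORTS W2 + W3 (brick B2):
# the ladder module `Z(3) = ladderPlus` is an IRREDUCIBLE ADMISSIBLE `(𝔲(2,1), K)`-module with an invariant Hermitian form

Cell hodgecm-mathlib (D-0151), FLOOR 0, crux item H413 = stmt-HodgeConjecture-24833; sub-line `Cruxes/H413/Lines/F0_LocalAPackets.lean`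
(F0P3b-plan (g5)∕(g6), edition 4K: T3a₁ decomposed into the Kovačević waypoints W1–W4 over the CONCRETE `K`-action `kTypeRep ladderPlus.S` of ★ A1
`Theorems/F0P3bKTypeIntegration` — RULING «W-STUBS CONCRETE» 2026-08-31T04:12:44Z).  Row B2 = W2 + W3 (F0P3b-plan (g5) GO 2026-08-31T03:50:43Z);
author A-p10 (g17).  PROOF lane (two closers restating the registered stub bodies `StubW2IrredAdm`, `StubW3Hermitian` VERBATIM, s347;
theorems only: no `def`, no `sorry`, no instance declaration, no notation, no named fact).  Imports: Kovačević's ★ `SU21Irreducible`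
(`ladderPlus_isIrreducible`) and ★ `SU21UnitarityRays` (`ladderPlus_isUnitarizable`), and the Kovačević-FREE generic transports ★ FILE A2
`Theorems/F0P3bKovLieTransports` (`isAdmissibleGK_kovLie_of_weightBasis`; transitively ★ K0 `BorelWallach2000/UpqComplexSpan` =
`upq_isIrreducibleGK_of_lieModule_isIrreducible`, ★ FILE A `Automorphic/GKModulesAdmissibleOfEigenspaces`, ★ (w4g) `Theorems/F0P3bU21Coordinates`,
★ (w3g) `Theorems/F0P3bU21Restriction` = `kovLie`, `hasInvariantHermitianForm_kovLie_of_signSkew`, and the defs leaf `Theorems/F0P3bLocalAPacketsDefs` =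
`G21`, `HasInvariantHermitianForm`), and ★ A1 `Theorems/F0P3bKTypeIntegration` (`kTypeRep`, the concrete `K`-action of the ed. 4K stubs) — NEVER the
Lines module; not on the R2 reverse cone.

Content (all for Kovačević's honest `𝔲(2,1)`-action `kovLie ladderPlus.ρ` on `ladderPlus.V = ⨁_{n ≥ 2} V_{n, 3n−3}`):
* §1 `irredAdm_of_isGKModule` — for EVERY compatible `K`-action `ρK` (`IsGKModule G21 ρK (kovLie ladderPlus.ρ)`), hence the ed. 4K stub
  `stubW2IrredAdm_holds` for `ρK := kTypeRep ladderPlus.S` under the W1 hypothesis: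
  (irreducible) a `(𝔤, K)`-submodule is `kovLie`-stable, hence — `kovLie ρ X v = ⁅reindex X, v⁆` with `reindex : 𝔤𝔩(Fin 2 ⊕ Fin 1) ≃ 𝔤𝔩(3)`
  surjective — `⊥` or `⊤` by ★ `ladderPlus_isIrreducible` through ★ K0; (admissible) `z₀ = diag(i, i | 0) ∈ 𝔨` acts through
  `kovLie ρ z₀ = (i∕3) · ρ(Z)`, `Z = E₀₀ + E₁₁ − 2E₂₂` (★ (w4g) `kovLie_upqZ0_of_map_one`, ★ `ρfun_one`), and `Z u^k_{n,m} = m u^k_{n,m}` (★ `lie_Z_vec`), so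
  Kovačević's `Finsupp` basis is a `Z`-eigenbasis with eigenvalue `m` on the label `(n, m, k)`; on the ladder `m = 3n − 3` determines `n`, and
  `1 ≤ k ≤ n`, so every eigenvalue has a FINITE fibre ⇒ ★ FILE A2 `isAdmissibleGK_kovLie_of_weightBasis` (⇐ ★ FILE A `isAdmissibleGK_of_basis_eigenvector`).
  (For a general `SU21Datum` the same argument needs `{n | (n, m) ∈ S}` finite for each `m` — true on every Kovačević ray, false on the cones,
  where one uses FILE A's `isAdmissibleGK_of_mem_adjoin_of_eigenspaces` with a polynomial in `Z` and the `𝔨`-Casimir instead.)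
* §2 `stubW3Hermitian_holds` — ★ `ladderPlus_isUnitarizable` (`B ⁅E_{ij}, v⁆ w = ε_i ε_j B v ⁅E_{ji}, w⁆`, `ε = suSign = (1, 1, −1)`) is exactly the
  sign-skewness hypothesis of ★ (w3g) `hasInvariantHermitianForm_kovLie_of_signSkew` (`⁅E_{ij}, v⁆ = ρ(E_{ij}) v` by ★ `lie_def`).

HONEST LABEL: HC_CM is proved only modulo the 7 printed citations until rung 0 closes; this file closes two registered stubs of ONE floor-0 sub-line.

## References
* [Kovacevic2021] D. Kovačević, *Unitary `(𝔤, K)`-modules of `SU(2,1)`*, Acta Math. Spalatensia 1 (2021) — §3 Def 1, Thm 1–3 (the `K`-types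
  `V_{n,m}`, `Z = H_α + 2H_β` acts by `m`, irreducibility), §4 Thm 4–5 (unitarizability of `Z(s)`).
* [BorelWallach2000] A. Borel, N. Wallach, *Continuous Cohomology, Discrete Subgroups, and Representations of Reductive Groups*, 2nd ed.,
  AMS 2000 — 0 §2.4–2.5 (admissible `(𝔤, K)`-modules), II §4.1 (`z₀`), VI Thm 4.11–4.12 (the cohomological modules of `SU(n,1)`, unitarity).
* [KnappVogan1995] A. W. Knapp, D. A. Vogan, *Cohomological Induction and Unitary Representations* (1995) — §I.3 (admissibility), §II.4.
-/

set_option autoImplicit false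
set_option linter.dupNamespace false

noncomputable section

namespace Summit.HodgeConjecture.HodgeConjecture.Cruxes.H413.F0P3bKovacevicTransports

open Literature.NumberTheory.Automorphic
open Literature.RepresentationTheory.BorelWallach2000
open Literature.RepresentationTheory.KonnoKonno2007 Literature.RepresentationTheory.KonnoKonno2007.RealDualPair
open Literature.RepresentationTheory.KonnoKonno2007.RealDualPair.UForm
open Summit.HodgeConjecture.HodgeConjecture.Cruxes.H413.F0P3bLocalAPacketsDefs
open Literature.RepresentationTheory.Kovacevic2021 Literature.RepresentationTheory.Kovacevic2021.SU21Datum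
open Summit.HodgeConjecture.HodgeConjecture.Cruxes.H413.F0P3bU21Restriction
open Summit.HodgeConjecture.HodgeConjecture.Cruxes.H413.F0P3bU21Coordinates
open Summit.HodgeConjecture.HodgeConjecture.Cruxes.H413.F0P3bKovLieTransports
open Summit.HodgeConjecture.HodgeConjecture.Cruxes.H413.F0P3bKTypeIntegration (KIdx kvec kTypeRep)

-- Mathlib idiom (as in `GKModules`, the `Upq*` files, the Kovačević topic, the defs leaf and the line): commutator bracket on `Module.End`
attribute [local instance 100] LieRing.ofAssociativeRing

/-! ## §1 W2 — `ladderPlus` is an irreducible admissible `(𝔲(2,1), K)`-module for every compatible `K`-action -/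

/-- The identity matrix acts by zero in Kovačević's `𝔰𝔩(3)`-normalisation (★ `ρfun_one`), in `ρ`-form. [cite: Kovacevic2021, §3] -/
theorem ladderPlus_rho_one : ladderPlus.ρ 1 = 0 := by
  rw [ρ_apply, ρfun_one]

/-- **Kovačević's basis is a `Z`-eigenbasis**: `ρ(Z) u^k_{n,m} = m u^k_{n,m}`, `Z = E₀₀ + E₁₁ − 2E₂₂` (★ `lie_Z_vec`), on the `Finsupp` basis of
`ladderPlus.V`. [cite: Kovacevic2021, §3 Def 1] -/
theorem rho_Z_basisSingleOne (t : ladderPlus.Idx) :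
    ladderPlus.ρ (Matrix.single 0 0 1 + Matrix.single 1 1 1 - (2 : ℂ) • Matrix.single 2 2 1) (Finsupp.basisSingleOne t) =
      ((t.1.2.1 : ℤ) : ℂ) • (Finsupp.basisSingleOne t : ladderPlus.V) := by
  obtain ⟨⟨n, m, k⟩, ht⟩ := t
  have hvec : ladderPlus.vec n m k = Finsupp.single (⟨(n, m, k), ht⟩ : ladderPlus.Idx) 1 := vec_of_pos n m k ht
  have hZ := ladderPlus.lie_Z_vec n m k
  rw [lie_def, hvec] at hZ
  rw [Finsupp.coe_basisSingleOne, ρ_apply]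
  exact hZ

/-- **The eigenvalue fibres are finite on the ladder**
(`m = 3n − 3` ★ `mem_ladderPlus`, `1 ≤ k ≤ n`): the labels `(n, m, k)` of `ladderPlus` with `m = c₀` form a finite set. [cite: Kovacevic2021, §4 Thm 5] -/
theorem finite_fibre_ladderPlus (c₀ : ℂ) :
    Set.Finite {t : ladderPlus.Idx | ((t.1.2.1 : ℤ) : ℂ) = c₀} := by
  by_cases hne : ∃ t₀ : ladderPlus.Idx, ((t₀.1.2.1 : ℤ) : ℂ) = c₀
  · obtain ⟨⟨⟨n₀, m₀, k₀⟩, hS₀, hk₀, hkn₀⟩, ht₀⟩ := hne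
    -- every label of the fibre has `m = m₀`, hence `n = n₀` (`m = 3n − 3`), and `1 ≤ k ≤ n₀`: the fibre embeds into a finite box
    have hT : (({n₀} : Set ℤ) ×ˢ (({m₀} : Set ℤ) ×ˢ Set.Icc (1 : ℤ) n₀)).Finite :=
      (Set.finite_singleton n₀).prod ((Set.finite_singleton m₀).prod (Set.finite_Icc 1 n₀))
    refine (hT.preimage Subtype.val_injective.injOn).subset ?_
    rintro ⟨⟨n, m, k⟩, hS, hk, hkn⟩ ht
    simp only [Set.mem_setOf_eq] at ht ht₀
    have hm : m = m₀ := by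
      have h : (m : ℂ) = (m₀ : ℂ) := ht.trans ht₀.symm
      exact_mod_cast h
    have hn : n = n₀ := by
      have h1 := ((mem_ladderPlus n m).1 hS).2
      have h2 := ((mem_ladderPlus n₀ m₀).1 hS₀).2
      omega
    subst hm hn
    exact ⟨rfl, rfl, hk, hkn⟩
  · refine Set.Finite.subset Set.finite_empty ?_
    intro t ht
    exact (hne ⟨t, ht⟩).elim

/-- **W2 for EVERY compatible `K`-action**: Kovačević's ladder module `Z(3)` with its honest `𝔲(2,1)`-action is an irreducible (★ K0 transport of
★ `ladderPlus_isIrreducible`) and admissible (★ FILE A2 at the `Z`-eigenbasis) `(𝔤, K)`-module for every `K`-action `ρK` making it a `(𝔤, K)`-module.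
[cite: Kovacevic2021, §3 Thm 3, §4 Thm 5; BorelWallach2000, 0 §2.5, VI Thm 4.11; KnappVogan1995, §I.3] -/
theorem irredAdm_of_isGKModule (ρK : Representation ℂ G21.maximalCompact ladderPlus.V)
    (hgk : IsGKModule G21 ρK (kovLie ladderPlus.ρ)) :
    IsIrreducibleGK ρK (kovLie ladderPlus.ρ) ∧ IsAdmissibleGK ρK := by
  refine ⟨?_, ?_⟩
  · -- irreducibility: K0 with `L = 𝔤𝔩(3, ℂ)`, `e = reindex`
    haveI : LieModule.IsIrreducible ℂ (Matrix (Fin 3) (Fin 3) ℂ) ladderPlus.V := ladderPlus_isIrreducible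
    refine upq_isIrreducibleGK_of_lieModule_isIrreducible (L := Matrix (Fin 3) (Fin 3) ℂ)
      ((Matrix.reindexLinearEquiv ℂ ℂ (finSumFinEquiv : Fin 2 ⊕ Fin 1 ≃ Fin 3) (finSumFinEquiv : Fin 2 ⊕ Fin 1 ≃ Fin 3) :
        Matrix (Fin 2 ⊕ Fin 1) (Fin 2 ⊕ Fin 1) ℂ ≃ₗ[ℂ] Matrix (Fin 3) (Fin 3) ℂ).toLinearMap)
      (LinearEquiv.surjective _) ρK (kovLie ladderPlus.ρ) fun X v => ?_
    rw [kovLie_apply, lie_def, ρ_apply]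
    rfl
  · -- admissibility: FILE A2 at Kovačević's `Z`-eigenbasis (finite fibres on the ladder)
    exact isAdmissibleGK_kovLie_of_weightBasis ladderPlus.ρ ladderPlus_rho_one
      (Finsupp.basisSingleOne : Module.Basis ladderPlus.Idx ℂ ladderPlus.V) (fun t => ((t.1.2.1 : ℤ) : ℂ))
      rho_Z_basisSingleOne finite_fibre_ladderPlus hgk

/-- **W2 · `StubW2IrredAdm` (ed. 4K, VERBATIM)**: for the concrete `K`-action `kTypeRep ladderPlus.S` (★ A1), given W1 (`IsGKModule`) as a
hypothesis, `(kTypeRep ladderPlus.S, kovLie ladderPlus.ρ)` is irreducible and admissible (`irredAdm_of_isGKModule`).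
[cite: Kovacevic2021, §3 Thm 3; BorelWallach2000, 0 §2.5] -/
theorem stubW2IrredAdm_holds :
    IsGKModule G21 (kTypeRep ladderPlus.S) (kovLie ladderPlus.ρ) →
      IsIrreducibleGK (kTypeRep ladderPlus.S) (kovLie ladderPlus.ρ) ∧ IsAdmissibleGK (kTypeRep ladderPlus.S) :=
  fun h1 => irredAdm_of_isGKModule (kTypeRep ladderPlus.S) h1

/-! ## §2 W3 — an invariant positive-definite Hermitian form -/

/-- **W3 · `StubW3Hermitian` (VERBATIM)**: Kovačević's ladder module carries a positive-definite Hermitian form for which every `kovLie X`,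
`X ∈ 𝔲(2,1)`, is skew — ★ `ladderPlus_isUnitarizable` read through ★ (w3g) `hasInvariantHermitianForm_kovLie_of_signSkew`.
[cite: Kovacevic2021, §4 Thm 4; BorelWallach2000, VI Thm 4.12] -/
theorem stubW3Hermitian_holds : HasInvariantHermitianForm (kovLie ladderPlus.ρ) := by
  obtain ⟨B, h1, h2, h3⟩ := ladderPlus_isUnitarizable
  refine hasInvariantHermitianForm_kovLie_of_signSkew ladderPlus.ρ B h1 h2 fun i j v w => ?_
  have h := h3 i j v w
  simp only [suSign, lie_def] at h
  simpa only [ρ_apply] using h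

end Summit.HodgeConjecture.HodgeConjecture.Cruxes.H413.F0P3bKovacevicTransports
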